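import Mathlib
import Summits.ValiantsHypothesis.ValiantsHypothesis.Theorems.GrenetZeonDualUnipotentThreeHalvesRadicalCoarseningFineFlag

/-!
# `GrenetZeon.DualUnipotentThreeHalves` (stmt-ValiantsHypothesis-24318) — line `radical_split`, stub R1: BRICK 2d,
# `FlagAdaptedUpTo` from an ARBITRARY stable flag (the interface BRICK 3's coarse flag will plug into)

HONEST FRAMING.  Helper file (`--supports stmt-ValiantsHypothesis-24318 --as helper`; val-lit port pool, seat
val-port-3 g0; desk g12 RULING #271 (a′) / #272 (d)).  BRICK 2c (`…RadicalCoarseningFineFlag`) proved the coordinate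
statement for the Loewy flag of an ideal; the greedy COARSENING of R1 (BRICK 3, not done) produces a different flag —
the coarse groups — with the same two properties (the constant part preserves it, the `s`-part climbs one COARSE
step on the chosen directions).  This file extracts the flag-agnostic form `flagAdaptedUpTo_of_flag`: ANY antitone
chain `F 0 = ⊤ ⊇ ⋯ ⊇ F L = ⊥` preserved by `M₀` and climbed by `M₁` yields the unfolded
`FlagAdaptedUpTo m (L-1) n M` (levels = chain layers, `p = L`, `r = a = 0`, one basis for all).  So BRICK 3 reduces to
pure linear algebra: build the coarse chain and bound the codimension of the climbing directions.  Nothing here proves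
R1 as registered, nothing bears on the rung `…Theses.GrenetZeon.DualUnipotentThreeHalves`, on 24318 / 8062, or on
`VP ≠ VNP` (NOT proved).  No definitions, no named facts.
[folklore] change of basis adapted to a flag.
-/

-- `Summit.ValiantsHypothesis.ValiantsHypothesis.…` is the tree's mandated single-conjunct layout (Sub = Summit).
set_option linter.dupNamespace false

noncomputable section

namespace Summit.ValiantsHypothesis.ValiantsHypothesis.Theorems.GrenetZeon.RadicalCoarsening

open Matrix MvPolynomial
open scoped BigOperators

section FlagCoords

variable {m : ℕ}

/-- **`FlagAdaptedUpTo` from a stable flag** (the unfolded `FlagAdaptedUpTo m (L-1) n M` of the line `radical_split`).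
Let `F 0 = ⊤ ⊇ F 1 ⊇ ⋯ ⊇ F L = ⊥` be an antitone chain of subspaces of `ℂ^m`, and `M` an `m × m` matrix of polynomials in
one variable `s` with no `s²` or higher, whose constant part `M₀` maps each `F t` into itself and whose `s`-part `M₁`
maps each `F t` into `F (t+1)`.  Then in a basis adapted to the chain (levels `lvl`, `p = L`, drop `0`, weight `0`,
budget `L − 1`) a non-zero `s^e`-coefficient of the conjugated matrix at `(i, j)` forces `e + lvl j ≤ lvl i`. [folklore] -/
theorem flagAdaptedUpTo_of_flag (F : ℕ → Submodule ℂ (Fin m → ℂ)) (hanti : Antitone F) (hF0 : F 0 = ⊤) {L : ℕ}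
    (hFL : F L = ⊥) (M : Matrix (Fin m) (Fin m) (MvPolynomial (Fin 1) ℂ))
    (h0 : ∀ t, ∀ w ∈ F t, (M.map (coeff 0)).mulVec w ∈ F t)
    (h1 : ∀ t, ∀ w ∈ F t, (M.map (coeff (Finsupp.single 0 1))).mulVec w ∈ F (t + 1))
    (h2 : ∀ d : Fin 1 →₀ ℕ, 2 ≤ d 0 → ∀ i j, coeff d (M i j) = 0) (n : ℕ) :
    ∃ (g : (Matrix (Fin m) (Fin m) ℂ)ˣ) (lvl : Fin m → ℕ) (p r a : ℕ),
      (∀ i, lvl i < p) ∧ (p - 1 + r * (n - 1)) / (a + 1) ≤ L - 1 ∧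
      ∀ (i j : Fin m) (d : Fin 1 →₀ ℕ),
        coeff d (((g : Matrix (Fin m) (Fin m) ℂ).map C * M * (↑g⁻¹ : Matrix (Fin m) (Fin m) ℂ).map C :
            Matrix (Fin m) (Fin m) (MvPolynomial (Fin 1) ℂ)) i j) ≠ 0 →
          (a + 1) * d 0 + lvl j ≤ lvl i + r := by
  classical
  obtain ⟨B, lvl, hli, hsp, hmemF, hlvlL, hspan⟩ := exists_adapted_set F hanti hF0 L hFL
  -- a basis indexed by `B`, then by `Fin m`
  have hli' : LinearIndependent ℂ (fun u : B => (u : Fin m → ℂ)) := hli.linearIndependent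
  have hsp' : ⊤ ≤ Submodule.span ℂ (Set.range fun u : B => (u : Fin m → ℂ)) := by
    rw [Subtype.range_coe, hsp]
  let bB : Module.Basis B ℂ (Fin m → ℂ) := Module.Basis.mk hli' hsp'
  haveI : Fintype B := hli'.setFinite.fintype
  have hcard : Fintype.card B = m := by
    have h := Module.finrank_eq_card_basis bB
    rw [Module.finrank_fin_fun] at h
    exact h.symm
  let e : B ≃ Fin m := Fintype.equivFinOfCardEq hcard
  let b : Module.Basis (Fin m) ℂ (Fin m → ℂ) := bB.reindex e
  have hb : ∀ i, b i = ((e.symm i : B) : Fin m → ℂ) := fun i => by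
    show (bB.reindex e) i = _
    rw [Module.Basis.reindex_apply, Module.Basis.mk_apply]
  have hbmem : ∀ i, b i ∈ B := fun i => by rw [hb]; exact (e.symm i).2
  -- coordinates supported on high levels
  have key : ∀ (t : ℕ) (w : Fin m → ℂ), w ∈ F t → ∀ i, b.repr w i ≠ 0 → t ≤ lvl (b i) := by
    intro t w hw i hi
    have hw' : w ∈ Submodule.span ℂ (b '' {i | t ≤ lvl (b i)}) := by
      refine Submodule.span_mono ?_ (hspan t hw)
      rintro u ⟨huB, hut⟩
      refine ⟨e ⟨u, huB⟩, ?_, ?_⟩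
      · show t ≤ lvl (b (e ⟨u, huB⟩))
        rw [hb, Equiv.symm_apply_apply]
        exact hut
      · rw [hb, Equiv.symm_apply_apply]
    have hsub := b.repr_support_subset_of_mem_span _ hw'
    exact hsub (Finsupp.mem_support_iff.2 hi)
  -- the change of basis
  let Q : Matrix (Fin m) (Fin m) ℂ := LinearMap.toMatrix' (b.equivFun : (Fin m → ℂ) →ₗ[ℂ] (Fin m → ℂ))
  let P : Matrix (Fin m) (Fin m) ℂ := LinearMap.toMatrix' (b.equivFun.symm : (Fin m → ℂ) →ₗ[ℂ] (Fin m → ℂ))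
  let g : (Matrix (Fin m) (Fin m) ℂ)ˣ :=
    ⟨Q, P, toMatrix'_equivFun_mul_symm b, toMatrix'_symm_mul_equivFun b⟩
  refine ⟨g, fun i => lvl (b i), L, 0, 0, ?_, ?_, ?_⟩
  · -- levels are `< L`: a basis vector of level `L` would lie in `F L = ⊥`
    intro i
    rcases (hlvlL (b i) (hbmem i)).lt_or_eq with hlt | heq
    · exact hlt
    · exfalso
      have hmem := hmemF (b i) (hbmem i)
      rw [heq, hFL, Submodule.mem_bot] at hmem
      exact b.ne_zero i hmem
  · simp
  · intro i j d hd
    show (0 + 1) * d 0 + lvl (b j) ≤ lvl (b i) + 0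
    have hg : ((g : (Matrix (Fin m) (Fin m) ℂ)ˣ) : Matrix (Fin m) (Fin m) ℂ) = Q := rfl
    have hg' : ((g⁻¹ : (Matrix (Fin m) (Fin m) ℂ)ˣ) : Matrix (Fin m) (Fin m) ℂ) = P := rfl
    rw [hg, hg', coeff_conj_apply] at hd
    have hdd : d = Finsupp.single 0 (d 0) := by
      refine Finsupp.ext fun t => ?_
      have ht : t = 0 := Subsingleton.elim t 0
      subst ht
      rw [Finsupp.single_eq_same]
    rcases Nat.lt_or_ge (d 0) 2 with hlt | hge
    · rcases (show d 0 = 0 ∨ d 0 = 1 by omega) with h | h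
      · -- constant part: `M₀ ∈ 𝒜` preserves the flag
        have hd0 : d = 0 := by rw [hdd, h, Finsupp.single_zero]
        rw [hd0, conj_entry_eq_repr] at hd
        have hw : (M.map (coeff 0)).mulVec (b j) ∈ F (lvl (b j)) := h0 _ _ (hmemF _ (hbmem j))
        have hle := key _ _ hw i hd
        rw [h]
        omega
      · -- `s`-part: `M₁ ∈ J` climbs
        have hd1 : d = Finsupp.single 0 1 := by rw [hdd, h]
        rw [hd1, conj_entry_eq_repr] at hd
        have hw : (M.map (coeff (Finsupp.single 0 1))).mulVec (b j) ∈ F (lvl (b j) + 1) :=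
          h1 _ _ (hmemF _ (hbmem j))
        have hle := key _ _ hw i hd
        rw [h]
        omega
    · -- no higher powers of `s`
      exfalso
      apply hd
      have hz : M.map (coeff d) = 0 := by
        ext k l
        rw [Matrix.map_apply, Matrix.zero_apply]
        exact h2 d hge k l
      rw [hz, Matrix.mul_zero, Matrix.zero_mul, Matrix.zero_apply]

end FlagCoords

end Summit.ValiantsHypothesis.ValiantsHypothesis.Theorems.GrenetZeon.RadicalCoarsening

end
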